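import Summits.AtomisticToContinuum.Crystallization.Theorems.FrustratedLawDichotomyStrainedPatchForceCap
import Summits.AtomisticToContinuum.Crystallization.Theorems.FrustratedLawDichotomyStrainedPatchHostCells
import Summits.AtomisticToContinuum.Crystallization.Theorems.FrustratedLawDichotomyStrainedPatchAugmentedEnvelope

/-!
# «RobustRows» — the force rows of the (FT) energy certificate made SOUND, and what that costs: the small-relative-texture regime,
# the a-priori regime, and the bridge (27623 T-side [CORE-FAR]; decomp-a2c lens-5 «finite range + asymptotic regime + bridge», generation 66)

AUDITED OBJECT.  The per-cell energy leaf of the T-side line of record (61H `TubeFloor FamP (1/80)` → 65F `FrameNetCert … (1/80)`, energy status (FT))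
is discharged by the census's AUGMENTED certificate (60A schema `certificate_schema`; engines AUG-60/61/62): `S̃(w) = S(z₀+w) − Σμc − Σ_a ν_a(σ₁² − ‖F_a‖²)
− Σ_a κ_a(τ² − ‖w_a‖²) ≤ S` by sign (`lagrange_dominance`, EXACT), minorised by a quadratic model whose S-part uses EXACT 1-D secant bond floors and whose
force part replaces `‖F_a(z₀+w)‖²` by the LINEARISED `‖J_a w‖²` ("the one remaining model-level item", census AUG61.md §0 / AUG62.md).  The census's own
Table 2 (AUG61.md) shows where the certificate's coercivity comes from: `λ_min(H_S(δ)) ≈ −3·10⁻²` (secant part INDEFINITE at every host and δ),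
`λ_min(H̃) ≈ +10⁻⁶ … +6·10⁻⁴` only after `+ 2Jᵀdiag(ν)J + 2diag(κ)` — i.e. FROM THE LINEARISED FORCE ROWS.

THE FINDING (§2, kernel arithmetic on the tree's `ljD2 = V''`).  Over the chart tube of `TubeFloor … τ`, `τ = 1/80`, a bond vector moves by up to `2τ = 1/40`
(relative texture of its two ends), and the Lennard-Jones bond stiffness over that range is NOT approximately constant: `ljD2 (39/40) > 99/10`, `ljD2 1 = 6`,
`ljD2 (41/40) < 7/2` (`ljD2_tube_spread`, `ljD2_antitone`: a factor `> 2.8` between the two ends of ONE nearest-neighbour bond's tube; `> ±53 %` around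
the host value; at compressed host bonds `r₀ = 0.95` the same `±48 %`).  Hence the rows `‖J_a w‖ ≤ σ₁` and the true cap `‖F_a‖ ≤ σ₁` describe sets that
differ at order one INSIDE the tube, and every SOUND replacement of the linearised rows prices out (memo NODE-g66 §3, `work/rowaudit.py`, census magnitudes
quoted): inflation `‖J w‖ ≤ (1+κ)σ₁` needs `κ ≈ 86` (the g57 `κ ≈ 287` phenomenon one tube smaller); cubic-error pricing costs `≈ 2.5 % S_hom` PER REACH SITE
at the mean multiplier (`×1420` sites); the θ-robust rows of §1 net NEGATIVE stiffness (`6–115 × ν` per bond-direction against a certificate stiffness scale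
`6·10⁻⁴`); and `ν ≡ 0` must buy the secant part's negative curvature with tube rows, `≈ 200 % S_hom`.  The rows become sound exactly in the regime of SMALL
RELATIVE TEXTURE `m := sup ‖dev b − dev a‖` over move-neighbour pairs of reach sites: at `m ≤ 1/200` the stiffness spread is `±10 %` and the crude
cubic-error price `≈ 13 % S_hom` (§5 of the audit table).  A-priori only `m ≤ 2τ = 1/40` is known (`relTexture_two_tau`, PROVED from `ChartBy`'s coarse clause).

THE NODE (this lens).  For any chart family `𝓘` and tolerance `τ`:
  ★★ `tubeFloor_of_relTexture_of_robustCert : RelTexture 𝓘 τ m → RobustTubeCert 𝓘 τ m → TubeFloor 𝓘 τ`   (BRIDGE, PROVED)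
  • **(LOC∇ m) `RelTexture 𝓘 τ m`** [ASYMPTOTIC-REGIME THEOREM · ANALYTIC · IDEA-NEEDED for `m < 2τ` · PROVED at `m = 2τ`]: every admissible clean
    mono-phase `τ`-charted cluster has relative texture `≤ m` on the move-neighbour pairs of its reach sites.  Mechanism on offer (memo §4): cage
    convexity (`Σ_k pairHess` uniformly positive on the tube — a kernel-checkable interval fact) turns the force cap into `‖z a − p⋆(cage)‖ ≤ σ₁/λ_cage
    ≈ 7·10⁻⁴`, the cage map is translation-exact and near-averaging, and a discrete Harnack / gradient estimate for near-averaging vector systems would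
    give `m ≲ C·τ/depth + 2σ₁/λ_cage`; NOT available near the rim (depth `< 1`), so the honest target is an INNER-BALL version (memo §4, ask AUG-63ν-inner).
  • **(FT∇ m) `RobustTubeCert 𝓘 τ m`** [FINITE RANGE · INSTRUMENTABLE with a SOUND format]: the tube floor for clusters whose relative texture is `≤ m` —
    the AUG certificate with the force rows replaced by the θ-robust rows of §1 (`normSq_ge_theta`, `lagrange_rows_robust`) or cubic-error rows
    (`normSq_ge_cubic`), the error functional `Σ_b ½M_ab‖Δ_ab‖²` priced at relative texture `m` (structured remainder (ROW∇) `ForceRowEnclosure`, which at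
    relative texture `m` GIVES g57's a-priori `ForceTaylorBound` with `ρ = m²·K/2`: `forceTaylorBound_of_rowEnclosure`).  At `m = 2τ` it IS `TubeFloor`
    (`robustTubeCert_two_tau_iff`) — the node is a genuine split only for `m < 2τ`, and the census decides the threshold `m⋆` (ask AUG-63m).
STRENGTH TAGS.  (LOC∇ 2τ): PROVED.  (LOC∇ m), m < 2τ: UNDECIDED · not known to imply [CORE-FAR] or the summit (a regularity statement about near-equilibrium
textures, no energy in it) · cheapest falsifier = census: relative-texture histogram of the M3′/AUG terminal states and of force-capped random textures
(ask LOC-66).  (FT∇ m): INSTRUMENTABLE · sound by §1 for any data · TRUE/FALSE per cell decided by the robust engine.  §1 and §2 are theorems (elementary).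
No `sorry`, no new axiom, no `instance`, no `notation`, no options.  Tree-only imports (`…ForceCap` = g57 QuantSlaving A/B + (FC σ₁) PROVED; `…HostCells` = 61H; `…AugmentedEnvelope` = 60A schema).
-/

namespace Summit.AtomisticToContinuum.Crystallization.Theorems.FrustratedLawDichotomyStrainedPatchRobustRows

open scoped BigOperators Classical RealInnerProductSpace
open Summit.AtomisticToContinuum.Crystallization.Theorems.FrustratedLawDichotomyMotifLemmas
open Summit.AtomisticToContinuum.Crystallization.Theorems.FrustratedLawDichotomyAveragingCut
open Summit.AtomisticToContinuum.Crystallization.Theorems.FrustratedLawDichotomyStrainedPatchHomSplit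
open Summit.AtomisticToContinuum.Crystallization.Theorems.FrustratedLawDichotomyStrainedPatchCleanCollar
open Summit.AtomisticToContinuum.Crystallization.Theorems.FrustratedLawDichotomyStrainedPatchPhaseCut
open Summit.AtomisticToContinuum.Crystallization.Theorems.FrustratedLawDichotomyStrainedPatchCoreTube
open Summit.AtomisticToContinuum.Crystallization.Theorems.FrustratedLawDichotomyStrainedPatchAugmentedEnvelope
open Summit.AtomisticToContinuum.Crystallization.Theorems.FrustratedLawDichotomyStrainedPatchEnvelopeLaw
open Summit.AtomisticToContinuum.Crystallization.Theorems.FrustratedLawDichotomyStrainedPatchEnvelopeTaylor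
open Summit.AtomisticToContinuum.Crystallization.Theorems.FrustratedLawDichotomyStrainedPatchChartFamilies
open Summit.AtomisticToContinuum.Crystallization.Theorems.FrustratedLawDichotomyStrainedPatchQuantSlaving
open Summit.AtomisticToContinuum.Crystallization.Theorems.FrustratedLawDichotomyStrainedPatchHostCells

/-! ## §1. Sound force rows: the θ-robust and the cubic lower bounds of `‖F‖²` through a linearisation `ℓ`, and the robust Lagrangian schema (PROVED) -/

section Algebra

variable {V : Type*} [NormedAddCommGroup V]

/-- **Cubic form.**  `‖ℓ‖² − 2‖ℓ‖·‖F − ℓ‖ ≤ ‖F‖²` for every `F, ℓ`: the linearised row under-estimates `‖F‖²` by at most `2‖ℓ‖·(remainder)`. [folklore] -/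
theorem normSq_ge_cubic (F ℓ : V) : ‖ℓ‖ ^ 2 - 2 * ‖ℓ‖ * ‖F - ℓ‖ ≤ ‖F‖ ^ 2 := by
  have hrev : ‖ℓ‖ - ‖F - ℓ‖ ≤ ‖F‖ := by
    have h := norm_sub_norm_le ℓ F
    rw [norm_sub_rev] at h
    linarith
  have hℓ := norm_nonneg ℓ
  have hd := norm_nonneg (F - ℓ)
  have hF := norm_nonneg F
  by_cases hcase : ‖F - ℓ‖ ≤ ‖ℓ‖
  · nlinarith [mul_le_mul_of_nonneg_left hrev (by linarith : (0 : ℝ) ≤ ‖ℓ‖ - ‖F - ℓ‖), sq_nonneg (‖F - ℓ‖)]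
  · rw [not_le] at hcase
    nlinarith

/-- **θ-robust form.**  For `0 < θ ≤ 1`: `(1 − θ)‖ℓ‖² − ((1 − θ)/θ)·‖F − ℓ‖² ≤ ‖F‖²` (Young with weight `θ/(1−θ)`; `θ = 1` is the empty row, `θ → 0` the
exact row with infinite remainder price). [folklore] -/
theorem normSq_ge_theta (F ℓ : V) {θ : ℝ} (h0 : 0 < θ) (h1 : θ ≤ 1) :
    (1 - θ) * ‖ℓ‖ ^ 2 - (1 - θ) / θ * ‖F - ℓ‖ ^ 2 ≤ ‖F‖ ^ 2 := by
  have hℓ := norm_nonneg ℓ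
  have hd := norm_nonneg (F - ℓ)
  have hF := norm_nonneg F
  have htri : ‖ℓ‖ ≤ ‖F‖ + ‖F - ℓ‖ := by
    have h := norm_sub_norm_le ℓ F
    rw [norm_sub_rev] at h
    linarith
  have hsq : ‖ℓ‖ ^ 2 ≤ (‖F‖ + ‖F - ℓ‖) ^ 2 := by
    exact pow_le_pow_left₀ hℓ htri 2
  have hkey : θ * ((1 - θ) * (‖F‖ + ‖F - ℓ‖) ^ 2) - (1 - θ) * ‖F - ℓ‖ ^ 2 ≤ θ * ‖F‖ ^ 2 := by
    nlinarith [sq_nonneg (θ * ‖F‖ - (1 - θ) * ‖F - ℓ‖)]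
  have h1' : 0 ≤ 1 - θ := by linarith
  have hmul : θ * ((1 - θ) * ‖ℓ‖ ^ 2) ≤ θ * ((1 - θ) * (‖F‖ + ‖F - ℓ‖) ^ 2) :=
    mul_le_mul_of_nonneg_left (mul_le_mul_of_nonneg_left hsq h1') h0.le
  have hdiv : (1 - θ) / θ * ‖F - ℓ‖ ^ 2 = ((1 - θ) * ‖F - ℓ‖ ^ 2) / θ := by ring
  rw [hdiv, sub_le_iff_le_add, ← sub_le_iff_le_add']
  rw [le_div_iff₀ h0]
  nlinarith

/-- **One robust force row.**  With a multiplier `ν ≥ 0`, cap `σ`, true force `F` and ANY linearisation `ℓ`: the Lagrangian term is bounded by the priced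
θ-robust quadratic expression — `−ν(σ² − ‖F‖²) ≥ −νσ² + ν(1−θ)‖ℓ‖² − ν((1−θ)/θ)‖F − ℓ‖²`. [folklore] -/
theorem robust_row {ν σ θ : ℝ} (hν : 0 ≤ ν) (h0 : 0 < θ) (h1 : θ ≤ 1) (F ℓ : V) :
    -(ν * σ ^ 2) + ν * ((1 - θ) * ‖ℓ‖ ^ 2) - ν * ((1 - θ) / θ * ‖F - ℓ‖ ^ 2) ≤ -(ν * (σ ^ 2 - ‖F‖ ^ 2)) := by
  have h := mul_le_mul_of_nonneg_left (normSq_ge_theta F ℓ h0 h1) hν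
  nlinarith

/-- **The robust rows summed** over a finite set of reach sites (multipliers `ν a ≥ 0`, one `θ`). [folklore] -/
theorem lagrange_rows_robust {ι : Type*} (s : Finset ι) {ν : ι → ℝ} {σ θ : ℝ} (hν : ∀ a ∈ s, 0 ≤ ν a) (h0 : 0 < θ) (h1 : θ ≤ 1) (F ℓ : ι → V) :
    -(σ ^ 2 * ∑ a ∈ s, ν a) + ∑ a ∈ s, ν a * ((1 - θ) * ‖ℓ a‖ ^ 2 - (1 - θ) / θ * ‖F a - ℓ a‖ ^ 2) ≤
      -∑ a ∈ s, ν a * (σ ^ 2 - ‖F a‖ ^ 2) := by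
  have h : ∀ a ∈ s, -(ν a * σ ^ 2) + ν a * ((1 - θ) * ‖ℓ a‖ ^ 2 - (1 - θ) / θ * ‖F a - ℓ a‖ ^ 2) ≤ -(ν a * (σ ^ 2 - ‖F a‖ ^ 2)) := by
    intro a ha
    have := robust_row (σ := σ) (hν a ha) h0 h1 (F a) (ℓ a)
    nlinarith
  have hs := Finset.sum_le_sum h
  rw [Finset.sum_add_distrib] at hs
  simp only [Finset.sum_neg_distrib] at hs
  have hσ : ∑ a ∈ s, ν a * σ ^ 2 = σ ^ 2 * ∑ a ∈ s, ν a := by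
    rw [Finset.mul_sum]
    exact Finset.sum_congr rfl fun a _ => by ring
  rw [hσ] at hs
  exact hs

/-- **Lagrangian dominance with SOUND force rows.**  On the force-capped class (`‖F a z‖ ≤ σ` at every row) the score dominates the priced robust quadratic
row expression: `S z − σ²Σν + Σ ν_a((1−θ)‖ℓ_a z‖² − ((1−θ)/θ)‖F_a z − ℓ_a z‖²) ≤ S z` — whatever the linearisation `ℓ`.  This is the force part of 60A's
`lagrange_dominance` with the model error made explicit instead of dropped. [folklore] -/
theorem score_dominates_robust_rows {ι X : Type*} (s : Finset ι) (S : X → ℝ) {ν : ι → ℝ} {σ θ : ℝ} (F ℓ : ι → X → V) {z : X}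
    (hν : ∀ a ∈ s, 0 ≤ ν a) (h0 : 0 < θ) (h1 : θ ≤ 1) (hcap : ∀ a ∈ s, ‖F a z‖ ≤ σ) :
    S z - σ ^ 2 * ∑ a ∈ s, ν a + ∑ a ∈ s, ν a * ((1 - θ) * ‖ℓ a z‖ ^ 2 - (1 - θ) / θ * ‖F a z - ℓ a z‖ ^ 2) ≤ S z := by
  have h := lagrange_rows_robust s (σ := σ) hν h0 h1 (fun a => F a z) (fun a => ℓ a z)
  have hc : 0 ≤ ∑ a ∈ s, ν a * (σ ^ 2 - ‖F a z‖ ^ 2) := by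
    refine Finset.sum_nonneg fun a ha => mul_nonneg (hν a ha) ?_
    have h1 := hcap a ha
    have h2 := norm_nonneg (F a z)
    have h3 : 0 ≤ σ + ‖F a z‖ := by linarith
    nlinarith [mul_nonneg (sub_nonneg.2 h1) h3]
  linarith

/-- ★ **THE CERTIFICATE SCHEMA WITH AN ERROR FUNCTIONAL.**  60A's `certificate_schema` where the quadratic model minorises the augmented score on the
tube only UP TO an error functional `Err` (the force-row remainder of §1, or any other dropped term) that is itself bounded by `E` on the tube:
floor `S̃ z₀ − ‖g‖²/(2λ) − E`.  A certificate that reports `Err` at the model minimiser only (AUG-61/62's «cubic remainder» column) has not bounded `E`. [folklore] -/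
theorem certificate_schema_err {X V : Type*} [NormedAddCommGroup V] [InnerProductSpace ℝ V] {A T : Set X} (hAT : A ⊆ T)
    (S Saug Err : X → ℝ) (z₀ : X) (w : X → V) (g : V) {lam E : ℝ} (hlam : 0 < lam)
    (hdom : ∀ z ∈ A, Saug z ≤ S z) (hmin : ∀ z ∈ T, Saug z₀ + ⟪g, w z⟫ + lam / 2 * ‖w z‖ ^ 2 - Err z ≤ Saug z) (hErr : ∀ z ∈ T, Err z ≤ E) :
    ∀ z ∈ A, Saug z₀ - ‖g‖ ^ 2 / (2 * lam) - E ≤ S z := by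
  intro z hz
  have h := quadModel_floor g (w z) hlam
  linarith [hdom z hz, hmin z (hAT hz), hErr z (hAT hz)]

end Algebra

/-! ## §2. The anharmonic stiffness spread of ONE Lennard-Jones bond over the `τ = 1/80` tube (PROVED, exact rationals) -/

/-- `V''` at the COMPRESSED end of a unit bond's tube (stretch `−2τ = −1/40`): `99/10 < ljD2 (39/40) < 10`. [numerical fact, exact] -/
theorem ljD2_at_39_40 : 99 / 10 < ljD2 (39 / 40) ∧ ljD2 (39 / 40) < 10 := by
  constructor <;> norm_num [ljD2]

/-- `V''` at the STRETCHED end (`+1/40`): `69/20 < ljD2 (41/40) < 7/2`. [numerical fact, exact] -/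
theorem ljD2_at_41_40 : 69 / 20 < ljD2 (41 / 40) ∧ ljD2 (41 / 40) < 7 / 2 := by
  constructor <;> norm_num [ljD2]

/-- `V''` at a `5 %`-compressed host bond: `16 < ljD2 (19/20) < 162/10`, and at `+5 %`: `18/10 < ljD2 (21/20) < 184/100`. [numerical fact, exact] -/
theorem ljD2_at_19_20_21_20 : (16 < ljD2 (19 / 20) ∧ ljD2 (19 / 20) < 162 / 10) ∧ (18 / 10 < ljD2 (21 / 20) ∧ ljD2 (21 / 20) < 184 / 100) := by
  refine ⟨⟨?_, ?_⟩, ?_, ?_⟩ <;> norm_num [ljD2]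

/-- `V''` is ANTITONE on `(0, 41/40]` (indeed up to the zero of `V'''` at `(13/4)^{1/6} ≈ 1.217`; this range is what the tube needs):
for `0 < r ≤ s ≤ 41/40`, `ljD2 s ≤ ljD2 r`.  Derivative-free: `13(u¹⁴ − v¹⁴) ≥ 13v⁶(u⁸ − v⁸) ≥ 7(u⁸ − v⁸)` for `u = r⁻¹ ≥ v = s⁻¹ ≥ 40/41`. [elementary] -/
theorem ljD2_antitone {r s : ℝ} (hr : 0 < r) (hrs : r ≤ s) (hs : s ≤ 41 / 40) : ljD2 s ≤ ljD2 r := by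
  have hs0 : 0 < s := lt_of_lt_of_le hr hrs
  set u := r⁻¹ with hu
  set v := s⁻¹ with hv
  have hv0 : 0 < v := inv_pos.2 hs0
  have huv : v ≤ u := by rw [hu, hv]; exact inv_anti₀ hr hrs
  have hv1 : 40 / 41 ≤ v := by
    rw [hv]
    have : (40 / 41 : ℝ) = (41 / 40)⁻¹ := by norm_num
    rw [this]
    exact inv_anti₀ hs0 hs
  have hu0 : 0 ≤ u := hv0.le.trans huv
  have h6 : v ^ 6 ≤ u ^ 6 := pow_le_pow_left₀ hv0.le huv 6
  have h8 : v ^ 8 ≤ u ^ 8 := pow_le_pow_left₀ hv0.le huv 8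
  have hv6 : 7 / 13 ≤ v ^ 6 := by
    have h := pow_le_pow_left₀ (by norm_num : (0 : ℝ) ≤ 40 / 41) hv1 6
    have h' : (7 / 13 : ℝ) ≤ (40 / 41) ^ 6 := by norm_num
    exact h'.trans h
  -- u¹⁴ − v¹⁴ = u⁸(u⁶ − v⁶) + v⁶(u⁸ − v⁸) ≥ v⁶(u⁸ − v⁸)
  have hkey : v ^ 6 * (u ^ 8 - v ^ 8) ≤ u ^ 14 - v ^ 14 := by
    have hu8 : 0 ≤ u ^ 8 := pow_nonneg hu0 8
    nlinarith [mul_nonneg hu8 (sub_nonneg.2 h6)]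
  show 13 * v ^ 14 - 7 * v ^ 8 ≤ 13 * u ^ 14 - 7 * u ^ 8
  nlinarith [mul_le_mul_of_nonneg_right hv6 (sub_nonneg.2 h8)]

/-- ★ **THE SPREAD.**  On a unit nearest-neighbour bond's tube `r ∈ [39/40, 41/40]` (`TubeFloor … (1/80)`: each end moves `≤ 1/80`), the LJ stiffness
satisfies `69/20 < ljD2 r < 10`, takes the host value `6` at `r = 1`, and the two ends differ by a factor `> 2.8`: `(28/10)·ljD2 (41/40) < ljD2 (39/40)`.
The linearised force row of the AUG certificates uses ONE stiffness per bond. [numerical fact, exact] -/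
theorem ljD2_tube_spread :
    (∀ r : ℝ, 39 / 40 ≤ r → r ≤ 41 / 40 → 69 / 20 < ljD2 r ∧ ljD2 r < 10) ∧ ljD2 1 = 6 ∧ 28 / 10 * ljD2 (41 / 40) < ljD2 (39 / 40) := by
  refine ⟨fun r h1 h2 => ⟨?_, ?_⟩, ljD2_one, ?_⟩
  · exact lt_of_lt_of_le ljD2_at_41_40.1 (ljD2_antitone (by linarith) h2 le_rfl)
  · exact lt_of_le_of_lt (ljD2_antitone (by norm_num) h1 h2) ljD2_at_39_40.2
  · nlinarith [ljD2_at_41_40.2, ljD2_at_39_40.1]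

/-- The RELATIVE spread on the unit tube is at least `±53 %` of the host stiffness: `ljD2 (39/40) − ljD2 (41/40) > 2·(53/100)·ljD2 1`. [numerical fact, exact] -/
theorem ljD2_tube_relSpread : 2 * (53 / 100) * ljD2 1 < ljD2 (39 / 40) - ljD2 (41 / 40) := by
  rw [ljD2_one]; nlinarith [ljD2_at_41_40.2, ljD2_at_39_40.1]

/-! ## §3. The typed node over the tree's chart API: (LOC∇ m) relative texture, (ROW∇) the structured row remainder, (FT∇ m) the robust tube certificate, bridges -/

/-- A table of second-derivative bounds of the pair force per instance pair: `Mtab M₀ z₀ c₀ b b' ≥ sup ‖D²φ‖` over the bond tube of `(b, b')` (census data;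
`φ(x) = (V'(‖x‖)/‖x‖)·x`, `‖D²φ(x)‖ ≤ 3|g'(r)| + r|g''(r)|`, `g(r) = −r⁻¹⁴ + r⁻⁸`: `≈ 197` on the unit tube, `work/rowaudit.py` §1). -/
abbrev CurvTab := (M₀ : ℕ) → (Fin M₀ → E3) → Fin M₀ → Fin M₀ → Fin M₀ → ℝ

/-- **RELATIVE TEXTURE of a chart on the reach**: `relTex z c z₀ c₀ e a b = ‖dev b − dev a‖` — what the force linearisation actually sees (a bond vector's
change), as opposed to the absolute deviation `‖dev a‖ ≤ τ` of `ChartBy`. -/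
noncomputable def relTex {M : ℕ} (z : Fin M → E3) (c : Fin M) {M₀ : ℕ} (z₀ : Fin M₀ → E3) (c₀ : Fin M₀) (e : Fin M → Fin M₀) (a b : Fin M) : ℝ :=
  ‖dev z c z₀ c₀ e b - dev z c z₀ c₀ e a‖

/-- ★★ **(LOC∇ m) `RelTexture 𝓘 τ m`** [ASYMPTOTIC-REGIME THEOREM · ANALYTIC · IDEA-NEEDED for `m < 2τ`; PROVED at `m = 2τ` (`relTexture_two_tau`)] —
every admissible `63/10`-clean `63/10`-mono-phase cluster `τ`-charted by an instance of `𝓘` has, at every REACH site `a` and every move-test neighbour `b`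
of `a` inside the charted ball, relative texture `‖dev b − dev a‖ ≤ m`.  The regime in which linearised force rows are sound is `m ≲ 1/200` (memo §3). -/
def RelTexture (𝓘 : ChartFam) (τ m : ℝ) : Prop :=
  ∀ (M : ℕ) (z : Fin M → E3) (c : Fin M) (M₀ : ℕ) (z₀ : Fin M₀ → E3) (c₀ : Fin M₀) (e : Fin M → Fin M₀),
    Admissible M z c → CleanBall (63 / 10) z c → MonoPhaseBall (63 / 10) z c → ChartBy 𝓘 τ τ z c z₀ c₀ e →
      ∀ a ∈ ball (63 / 10) z c, IsReach z c a → ∀ b ∈ moveNbrs 7 z a, b ∈ ball (63 / 10) z c → relTex z c z₀ c₀ e a b ≤ m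

/-- ★★ **(FT∇ m) `RobustTubeCert 𝓘 τ m`** [FINITE RANGE · INSTRUMENTABLE WITH A SOUND FORMAT] — the tube floor RESTRICTED to charts of relative texture `≤ m`
on the reach: the statement the robust AUG engine certifies per cell (force rows by `score_dominates_robust_rows` / `normSq_ge_cubic` with the remainder
functional priced at relative texture `m`; secant, tube and Boolean window rows exact). -/
def RobustTubeCert (𝓘 : ChartFam) (τ m : ℝ) : Prop :=
  ∀ (M : ℕ) (z : Fin M → E3) (c : Fin M) (M₀ : ℕ) (z₀ : Fin M₀ → E3) (c₀ : Fin M₀) (e : Fin M → Fin M₀),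
    Admissible M z c → CleanBall (63 / 10) z c → MonoPhaseBall (63 / 10) z c → ChartBy 𝓘 τ τ z c z₀ c₀ e →
      (∀ a ∈ ball (63 / 10) z c, IsReach z c a → ∀ b ∈ moveNbrs 7 z a, b ∈ ball (63 / 10) z c → relTex z c z₀ c₀ e a b ≤ m) →
        0 ≤ ballAvg (9 / 5) z (xRec M z) c

/-- ★★ **THE BRIDGE** — (LOC∇ m) ∧ (FT∇ m) ⟹ (TF): the asymptotic-regime theorem feeds the finite-range certificate. [formal bookkeeping] -/
theorem tubeFloor_of_relTexture_of_robustCert {𝓘 : ChartFam} {τ m : ℝ} (hL : RelTexture 𝓘 τ m) (hC : RobustTubeCert 𝓘 τ m) : TubeFloor 𝓘 τ :=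
  fun M z c M₀ z₀ c₀ e hz hcl hmo hch => hC M z c M₀ z₀ c₀ e hz hcl hmo hch (hL M z c M₀ z₀ c₀ e hz hcl hmo hch)

/-- Conversely the tube floor is the robust certificate at every `m`. [formal bookkeeping] -/
theorem robustTubeCert_of_tubeFloor {𝓘 : ChartFam} {τ : ℝ} (h : TubeFloor 𝓘 τ) (m : ℝ) : RobustTubeCert 𝓘 τ m :=
  fun M z c M₀ z₀ c₀ e hz hcl hmo hch _ => h M z c M₀ z₀ c₀ e hz hcl hmo hch

/-- (LOC∇) is ANTITONE-free in `m` upward: a smaller relative texture bound implies a larger one. [formal bookkeeping] -/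
theorem RelTexture.mono {𝓘 : ChartFam} {τ m m' : ℝ} (h : RelTexture 𝓘 τ m) (hle : m ≤ m') : RelTexture 𝓘 τ m' :=
  fun M z c M₀ z₀ c₀ e hz hcl hmo hch a ha hr b hb hb' => (h M z c M₀ z₀ c₀ e hz hcl hmo hch a ha hr b hb hb').trans hle

/-- (FT∇) is MONOTONE in `m` downward: a certificate valid up to relative texture `m'` is valid up to any `m ≤ m'`. [formal bookkeeping] -/
theorem RobustTubeCert.anti {𝓘 : ChartFam} {τ m m' : ℝ} (h : RobustTubeCert 𝓘 τ m') (hle : m ≤ m') : RobustTubeCert 𝓘 τ m :=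
  fun M z c M₀ z₀ c₀ e hz hcl hmo hch hm => h M z c M₀ z₀ c₀ e hz hcl hmo hch fun a ha hr b hb hb' => (hm a ha hr b hb hb').trans hle

/-- (LOC∇) restricts along sub-families; (FT∇) too. [formal bookkeeping] -/
theorem RelTexture.anti_family {𝓘 𝓘' : ChartFam} (hle : ∀ M₀ z₀ c₀, 𝓘 M₀ z₀ c₀ → 𝓘' M₀ z₀ c₀) {τ m : ℝ} (h : RelTexture 𝓘' τ m) :
    RelTexture 𝓘 τ m :=
  fun M z c M₀ z₀ c₀ e hz hcl hmo hch => h M z c M₀ z₀ c₀ e hz hcl hmo ⟨hle _ _ _ hch.1, hch.2⟩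

/-- (FT∇) restricts along sub-families (companion of `RelTexture.anti_family`). [formal bookkeeping] -/
theorem RobustTubeCert.anti_family {𝓘 𝓘' : ChartFam} (hle : ∀ M₀ z₀ c₀, 𝓘 M₀ z₀ c₀ → 𝓘' M₀ z₀ c₀) {τ m : ℝ} (h : RobustTubeCert 𝓘' τ m) :
    RobustTubeCert 𝓘 τ m :=
  fun M z c M₀ z₀ c₀ e hz hcl hmo hch => h M z c M₀ z₀ c₀ e hz hcl hmo ⟨hle _ _ _ hch.1, hch.2⟩

/-- The coarse clause of `ChartBy` IS `‖dev a‖ ≤ τ` on the charted ball. [formal bookkeeping] -/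
theorem norm_dev_le_of_chartBy {𝓘 : ChartFam} {τ t : ℝ} {M : ℕ} {z : Fin M → E3} {c : Fin M} {M₀ : ℕ} {z₀ : Fin M₀ → E3} {c₀ : Fin M₀}
    {e : Fin M → Fin M₀} (h : ChartBy 𝓘 τ t z c z₀ c₀ e) {a : Fin M} (ha : a ∈ ball (63 / 10) z c) : ‖dev z c z₀ c₀ e a‖ ≤ τ := by
  have h1 := h.2.2.1 a ((mem_ball).1 ha)
  rw [dist_eq_norm] at h1
  exact h1

/-- ★ **(LOC∇ 2τ) PROVED — the a-priori regime.**  Relative texture `≤ 2τ` is automatic from the chart's coarse clause (both ends in the ball). -/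
theorem relTexture_two_tau (𝓘 : ChartFam) (τ : ℝ) : RelTexture 𝓘 τ (2 * τ) := by
  intro M z c M₀ z₀ c₀ e _ _ _ hch a ha _ b _ hb'
  have ha' := norm_dev_le_of_chartBy hch ha
  have hb'' := norm_dev_le_of_chartBy hch hb'
  calc relTex z c z₀ c₀ e a b = ‖dev z c z₀ c₀ e b - dev z c z₀ c₀ e a‖ := rfl
    _ ≤ ‖dev z c z₀ c₀ e b‖ + ‖dev z c z₀ c₀ e a‖ := norm_sub_le _ _
    _ ≤ τ + τ := add_le_add hb'' ha'
    _ = 2 * τ := by ring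

/-- ★ At `m = 2τ` the split is NOT a split: (FT∇ 2τ) ⟺ (TF).  The node has content exactly for `m < 2τ`. [formal bookkeeping] -/
theorem robustTubeCert_two_tau_iff (𝓘 : ChartFam) (τ : ℝ) : RobustTubeCert 𝓘 τ (2 * τ) ↔ TubeFloor 𝓘 τ :=
  ⟨fun h => tubeFloor_of_relTexture_of_robustCert (relTexture_two_tau 𝓘 τ) h, fun h => robustTubeCert_of_tubeFloor h _⟩

/-- ★ **(ROW∇ K X) `ForceRowEnclosure 𝓘 τ K H F X`** [ANALYTIC · ATTACKABLE (M): second-order Taylor of each pair force along its own bond vector, summed] —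
the STRUCTURED remainder of the force linearisation: at every reach site `a` of a `τ`-chart, `‖F_a − ℓ_a‖ ≤ K(z₀)(e a)·(max relative texture at a)² + X(z₀)(e a)`,
where `K ≥ ½ Σ_b M_ab` bounds half the summed pair-force curvatures over the bond tubes (`≈ 1200` on the unit shell) and `X` is g57's unmodelled column.
Compare g57's STRUCTURE-FREE `ForceTaylorBound ρ` (one constant `ρ` for the whole tube): (ROW∇) keeps the dependence on the relative texture. -/
def ForceRowEnclosure (𝓘 : ChartFam) (τ : ℝ) (K : SlackTab) (H : HessTab) (F : ForceTab) (X : SlackTab) : Prop :=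
  ∀ (M : ℕ) (z : Fin M → E3) (c : Fin M) (M₀ : ℕ) (z₀ : Fin M₀ → E3) (c₀ : Fin M₀) (e : Fin M → Fin M₀) (m : ℝ),
    Admissible M z c → CleanBall (63 / 10) z c → MonoPhaseBall (63 / 10) z c → ChartBy 𝓘 τ τ z c z₀ c₀ e → 0 ≤ m →
      ∀ a ∈ ball (63 / 10) z c, IsReach z c a → (∀ b ∈ moveNbrs 7 z a, b ∈ ball (63 / 10) z c → relTex z c z₀ c₀ e a b ≤ m) →
        ‖siteForce 7 z a - linForce H F z c z₀ c₀ e a‖ ≤ K M₀ z₀ c₀ (e a) * m ^ 2 + X M₀ z₀ c₀ (e a)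

/-- ★ **(ROW∇) at relative texture `m` GIVES g57's a-priori remainder bound** with `ρ = K⋆·m²` (`K⋆` a uniform bound of the curvature column): the bridge from
this node to the «QuantSlaving» architecture (`slavingEnclosure_of_forceCap` then yields (ENC κ) with `κσ = K⋆m²` — useful iff `m` is small). [formal bookkeeping] -/
theorem forceTaylorBound_of_rowEnclosure {𝓘 : ChartFam} {τ δ : ℝ} {T : LawTab} {K : SlackTab} {H : HessTab} {F : ForceTab} {X : SlackTab} {m Kstar : ℝ}
    (hR : ForceRowEnclosure 𝓘 τ K H F X) (hL : RelTexture 𝓘 τ m) (hm : 0 ≤ m) (hK : ∀ M₀ z₀ c₀ b, K M₀ z₀ c₀ b ≤ Kstar) :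
    ForceTaylorBound 𝓘 τ δ T (Kstar * m ^ 2) H F X := by
  intro M z c M₀ z₀ c₀ e t hz hcl hmo _ _ hch _ a ha hr
  have hch' : ChartBy 𝓘 τ τ z c z₀ c₀ e := chartBy_fine_self hch
  have h := hR M z c M₀ z₀ c₀ e m hz hcl hmo hch' hm a ha hr (hL M z c M₀ z₀ c₀ e hz hcl hmo hch' a ha hr)
  have hKm : K M₀ z₀ c₀ (e a) * m ^ 2 ≤ Kstar * m ^ 2 := mul_le_mul_of_nonneg_right (hK M₀ z₀ c₀ (e a)) (sq_nonneg m)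
  linarith

/-! ## §4. Records: the node at the line-of-record family and tolerance, and the junction to [CORE-FAR] through 61H -/

/-- ★★★ **RECORD (this node, 61H currency).**  [CORE-FAR] ⟸ (LOC∇ m) on `FamP` at `τ = 1/80` · (FT∇ m) · the 61H pure cover `CoverP`:
`RelTexture FamP (1/80) m → RobustTubeCert FamP (1/80) m → CoverP → CoreOffTubeFloor (63/10) (63/10) (24/5) (1/100) 0`. -/
theorem coreOff_record_g66 (m : ℝ) (hL : RelTexture FamP (1 / 80) m) (hC : RobustTubeCert FamP (1 / 80) m) (hcov : CoverP) :
    CoreOffTubeFloor (63 / 10) (63 / 10) (24 / 5) (1 / 100) 0 :=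
  coreOff_record_of_tubeP_of_coverP (tubeFloor_of_relTexture_of_robustCert hL hC) hcov

/-- The record at the a-priori regime `m = 1/40` is 61H's record verbatim ((LOC∇ 1/40) being a theorem): no progress is claimed THERE — the node's content is
the measured threshold `m⋆ < 1/40` at which (FT∇ m⋆) becomes certifiable with sound rows, and the open theorem (LOC∇ m⋆). [formal bookkeeping] -/
theorem coreOff_record_g66_apriori (hT : TubeP) (hcov : CoverP) : CoreOffTubeFloor (63 / 10) (63 / 10) (24 / 5) (1 / 100) 0 :=
  coreOff_record_g66 (2 * (1 / 80)) (relTexture_two_tau FamP (1 / 80)) (robustTubeCert_of_tubeFloor hT _) hcov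

end Summit.AtomisticToContinuum.Crystallization.Theorems.FrustratedLawDichotomyStrainedPatchRobustRows
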